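import Summits.Schanuel.Schanuel.Theorems.RootDecomp1HMirror

/-!
# RootDecomp1HMirror — part 3/3: the re-cut of the symmetry piece (§3: node-local items `FirstFailureNearStable`, `ObliqueLift`, the deciding theorems `closes₁₂` / `closes₁₁` / `closes_live` over the LIVE binders) + the Σ-design (§5, demonstration, not filed)

Continuation of `RootDecomp1HMirror` (lens 5 gen 12; critic g5 14:49:48Z PATH T — the items stay node-local `def … : Prop`s in this theorem round; PATH A′ banked).
`--supports stmt-Schanuel-27286`. Sorry-free; standard axioms. Nothing here proves Schanuel; rung 0.
-/

noncomputable section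

set_option linter.dupNamespace false

namespace Summit.Schanuel.Schanuel.Theorems.RootDecomp1HMirror

open Complex Set
open Literature.NumberTheory.Transcendental
open Literature.NumberTheory.Transcendental.GammaField
open Summit.Schanuel.Schanuel.Theses.RootDecomp1H

variable {n : ℕ}

/-! ## §3 The re-cut of the symmetry piece (items, raw texts) and the deciding theorem with it -/

/-- PROPOSED CRUX (replaces `FirstFailureConjStable` as a binder of `closes`; WEAKER): **a first failure is NEARLY
conjugation-stable** — `σ(span x) ≤ span x + ℚ z` for some `z` (obliqueness `≤ 1`). Raw text over tree constants. -/
def FirstFailureNearStable : Prop :=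
  ∀ (n : ℕ) (x : Fin n → ℂ), ((∀ m < n, Literature.NumberTheory.Transcendental.SchanuelRank m) ∧ LinearIndependent ℚ x ∧ Algebra.trdeg ℚ ↥(IntermediateField.adjoin ℚ (Set.range x ∪ Set.range (Complex.exp ∘ x))) < (n : Cardinal)) → ∃ z : ℂ, ∀ j, (starRingEnd ℂ) (x j) ∈ Submodule.span ℚ (insert z (Set.range x))

/-- PROPOSED SUPPORT (PROVED below, `obliqueLift_holds`): **a nearly-stable first failure has a conjugation-stable
sibling at the same rank** (the sibling theorem `T₁` in item form). Raw text over tree constants. -/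
def ObliqueLift : Prop :=
  ∀ (n : ℕ) (x : Fin n → ℂ), ((∀ m < n, Literature.NumberTheory.Transcendental.SchanuelRank m) ∧ LinearIndependent ℚ x ∧ Algebra.trdeg ℚ ↥(IntermediateField.adjoin ℚ (Set.range x ∪ Set.range (Complex.exp ∘ x))) < (n : Cardinal)) → (∃ z : ℂ, ∀ j, (starRingEnd ℂ) (x j) ∈ Submodule.span ℚ (insert z (Set.range x))) → ∃ x' : Fin n → ℂ, (LinearIndependent ℚ x' ∧ Algebra.trdeg ℚ ↥(IntermediateField.adjoin ℚ (Set.range x' ∪ Set.range (Complex.exp ∘ x'))) < (n : Cardinal)) ∧ ∀ j, (starRingEnd ℂ) (x' j) ∈ Submodule.span ℚ (Set.range x')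

/-- The support item holds (it is `conjStable_sibling`). -/
theorem obliqueLift_holds : ObliqueLift :=
  fun _ _ hx hz => conjStable_sibling hx.1 hx.2.1 hx.2.2 hz

/-- WEAKER: the live crux `FirstFailureConjStable` (stmt-Schanuel-27286) implies the proposed one (`z := 0`). -/
theorem firstFailureNearStable_of_conjStable (h : FirstFailureConjStable) : FirstFailureNearStable :=
  fun n x hx => ⟨0, fun j => Submodule.span_mono (Set.subset_insert _ _) (h n x hx j)⟩

/-- Necessity: Schanuel implies the proposed crux (vacuously — no counterexamples). -/
theorem firstFailureNearStable_of_schanuel (h : _root_.Schanuel) : FirstFailureNearStable :=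
  fun n x hx => absurd (h n x hx.2.1) (not_le.2 hx.2.2)

/-- In the other direction the two cruxes differ EXACTLY by the sibling theorem: `FirstFailureNearStable ∧ ObliqueLift`
give, at every first-failure rank, a conjugation-STABLE first failure — which is all `closes` ever used `h₁` for. -/
theorem exists_conjStable_firstFailure (h₁ : FirstFailureNearStable) (h₉ : ObliqueLift) {x : Fin n → ℂ}
    (hx : (∀ m < n, SchanuelRank m) ∧ LinearIndependent ℚ x ∧
      Algebra.trdeg ℚ ↥(IntermediateField.adjoin ℚ (range x ∪ range (cexp ∘ x))) < (n : Cardinal)) :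
    ∃ x' : Fin n → ℂ, ((∀ m < n, SchanuelRank m) ∧ LinearIndependent ℚ x' ∧
      Algebra.trdeg ℚ ↥(IntermediateField.adjoin ℚ (range x' ∪ range (cexp ∘ x'))) < (n : Cardinal)) ∧
      ∀ j, (starRingEnd ℂ) (x' j) ∈ Submodule.span ℚ (range x') := by
  obtain ⟨x', hx', hcs⟩ := h₉ n x hx (h₁ n x hx)
  exact ⟨x', ⟨hx.1, hx'⟩, hcs⟩

/-- **DECIDING THEOREM, round 12** (ten binders; `h₁` re-cut into `FirstFailureNearStable` + the proved support
`ObliqueLift`; everything else verbatim the live `closes` of rev 14/15). -/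
theorem closes₁₂ (h₀ : StarLocalisation) (h₁ : FirstFailureNearStable) (h₉ : ObliqueLift) (h₂ : FinCS)
    (h₃ : ProductSchanuel) (h₄ : RelTowerSchanuel) (h₅ : BridgeTransverse) (h₆ : BridgeCSGlue)
    (h₇ : BridgeCoupledGlue) (h₈ : BridgeCyclicGlue) : _root_.Schanuel := by
  show ∀ n, Literature.NumberTheory.Transcendental.SchanuelRank n
  intro n
  induction n using Nat.strong_induction_on with
  | _ n ih =>
    intro x hli
    by_contra hlt
    rw [not_le] at hlt
    obtain ⟨x', hx', hcs'⟩ := exists_conjStable_firstFailure h₁ h₉ ⟨ih, hli, hlt⟩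
    obtain ⟨c, y, hy, hycs, hopt⟩ := h₀ n x' hx' hcs'
    rcases h₂ n c hy.1 y hopt hycs with hdep | hfree
    · exact hdep hy.2.1
    · exact hfree ((h₆ h₃ (h₇ h₃ h₄ (h₈ h₃ h₄ h₅))) n c hy.1 y hopt hycs hy.2)

/-- Nine binders: the support `ObliqueLift` discharged by its proof. -/
theorem closes₁₁ (h₀ : StarLocalisation) (h₁ : FirstFailureNearStable) (h₂ : FinCS)
    (h₃ : ProductSchanuel) (h₄ : RelTowerSchanuel) (h₅ : BridgeTransverse) (h₆ : BridgeCSGlue)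
    (h₇ : BridgeCoupledGlue) (h₈ : BridgeCyclicGlue) : _root_.Schanuel :=
  closes₁₂ h₀ h₁ obliqueLift_holds h₂ h₃ h₄ h₅ h₆ h₇ h₈

/- `closes_live` (the node's restatement of the LIVE nine-binder `RootDecomp1H.closes`, showing the round is a pure weakening of h₁)
is NOT ported: a print-twin of the live deciding theorem (gate dedup); see the node file g12/Mirror.lean. -/


/-! ## §5 The Σ-DESIGN (demonstration, not filed): index the induction by `σ`-STABLE rank and the symmetry piece disappears

Abbreviations below are DEFINITIONALLY the inline blocks of the live item texts (`finCS_iff` … are `Iff.rfl`); the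
`σ`-items are the live texts with «`∀ m < n, SchanuelRank m`» replaced by «`∀ m < n, ConjSchanuelRank m`» (spelled raw).
-/

/-- (abbrev.) `y` near-presents its span at complexity `c` and `c` is least (`c⋆`-near-optimality) — the inline block of
`FinCS` / `BridgeCS` / `BridgeTransverse` / `StarLocalisation`. -/
def NearOpt (n c : ℕ) (y : Fin n → ℂ) : Prop :=
  ((∃ g : Fin n → MvPolynomial (Fin n ⊕ Fin n) ℚ, (∀ i, max (g i).totalDegree ((g i).support.sup fun m => max ((g i).coeff m).num.natAbs ((g i).coeff m).den) ≤ c) ∧ (∀ i, MvPolynomial.aeval (Sum.elim y (Complex.exp ∘ y)) (g i) = 0) ∧ (Matrix.of fun i j => MvPolynomial.aeval (Sum.elim y (Complex.exp ∘ y)) (Literature.NumberTheory.Transcendental.Khovanskii.ePD j (g i))).det ≠ 0) ∧ ‖y‖ ≤ ((4 ^ c : ℕ) : ℝ)) ∧ ∀ c' < c, ¬ (∃ y' : Fin n → ℂ, Submodule.span ℚ (Set.range y) = Submodule.span ℚ (Set.range y') ∧ (∃ g' : Fin n → MvPolynomial (Fin n ⊕ Fin n) ℚ, (∀ i, max (g'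 i).totalDegree ((g' i).support.sup fun m => max ((g' i).coeff m).num.natAbs ((g' i).coeff m).den) ≤ c') ∧ (∀ i, MvPolynomial.aeval (Sum.elim y' (Complex.exp ∘ y')) (g' i) = 0) ∧ (Matrix.of fun i j => MvPolynomial.aeval (Sum.elim y' (Complex.exp ∘ y')) (Literature.NumberTheory.Transcendental.Khovanskii.ePD j (g' i))).det ≠ 0) ∧ ‖y'‖ ≤ ((4 ^ c' : ℕ) : ℝ))

/-- (abbrev.) the conclusion «a system of `n+1` small integer relations with free Jacobian rows holds at `(y, eʸ)`». -/
def FreeRel (n c : ℕ) (y : Fin n → ℂ) : Prop :=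
  ∃ P : Fin (n + 1) → MvPolynomial (Fin n ⊕ Fin n) ℤ, (∀ i, max (P i).totalDegree ((P i).support.sup fun m => ((P i).coeff m).natAbs) ≤ c + 3) ∧ (∀ i, MvPolynomial.aeval (Sum.elim y (Complex.exp ∘ y)) (P i) = 0) ∧ LinearIndependent ℂ (fun i => fun s : Fin n ⊕ Fin n => MvPolynomial.aeval (Sum.elim y (Complex.exp ∘ y)) (MvPolynomial.pderiv s (P i)))

/-- (abbrev.) conjugation-stability of the span of a tuple. -/
def CS (y : Fin n → ℂ) : Prop := ∀ j, (starRingEnd ℂ) (y j) ∈ Submodule.span ℚ (Set.range y)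

/-- (abbrev.) «`ℚ`-free counterexample of rank `n`». -/
def CE (n : ℕ) (y : Fin n → ℂ) : Prop :=
  LinearIndependent ℚ y ∧ Algebra.trdeg ℚ ↥(IntermediateField.adjoin ℚ (Set.range y ∪ Set.range (Complex.exp ∘ y))) < (n : Cardinal)

/-- The item `FinCS` unfolded in the local shorthands (by `Iff.rfl`). -/
theorem finCS_iff : FinCS ↔ ∀ (n c : ℕ), (∀ m < n, SchanuelRank m) → ∀ y : Fin n → ℂ, NearOpt n c y → CS y →
    (¬ LinearIndependent ℚ y ∨ ¬ FreeRel n c y) := Iff.rfl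

/-- The item `BridgeCS` unfolded in the local shorthands (by `Iff.rfl`). -/
theorem bridgeCS_iff : BridgeCS ↔ ∀ (n c : ℕ), (∀ m < n, SchanuelRank m) → ∀ y : Fin n → ℂ, NearOpt n c y → CS y →
    CE n y → FreeRel n c y := Iff.rfl

/-- The item `StarLocalisation` unfolded in the local shorthands (by `Iff.rfl`). -/
theorem starLocalisation_iff : StarLocalisation ↔ ∀ (n : ℕ) (x : Fin n → ℂ), ((∀ m < n, SchanuelRank m) ∧ CE n x) → CS x →
    ∃ c : ℕ, ∃ y : Fin n → ℂ, ((∀ m < n, SchanuelRank m) ∧ CE n y) ∧ CS y ∧ NearOpt n c y := Iff.rfl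

/-- `σ`-lower ranks: Schanuel below rank `n` at `σ`-STABLE tuples only. -/
def ConjLowerRanks (n : ℕ) : Prop := ∀ m < n, ConjSchanuelRank m

/-- Lower ranks imply σ-lower ranks. -/
theorem conjLowerRanks_of_lowerRanks (h : ∀ m < n, SchanuelRank m) : ConjLowerRanks n :=
  fun m hm => conjSchanuelRank_of_schanuelRank (h m hm)

/-- Σ-item (support, OPEN — the `σ`-LOCALISATION; see NODE-g12 §6 for the proof plan: Khovanskii dichotomy, and if an
E-derivation `D ≠ 0` of `L = ℚ(x, eˣ)` exists (`x` an adapted `±`-basis, so `σL = L`), one of `D + D^σ`, `D` has a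
`σ`-stable constant space, to which `ConjLowerRanks` applies in Ax's theorem with the rank term):
a `σ`-stable counterexample under the `σ`-lower ranks is a non-degenerate Khovanskii point. -/
def SigmaPresentable : Prop :=
  ∀ (n : ℕ) (x : Fin n → ℂ), ConjLowerRanks n → CE n x → CS x →
    ∃ g : Fin n → MvPolynomial (Fin n ⊕ Fin n) ℚ, (∀ i, MvPolynomial.aeval (Sum.elim x (Complex.exp ∘ x)) (g i) = 0) ∧
      (Matrix.of fun i j => MvPolynomial.aeval (Sum.elim x (Complex.exp ∘ x)) (Literature.NumberTheory.Transcendental.Khovanskii.ePD j (g i))).det ≠ 0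

/-- Σ-item `StarLocalisationσ` (support): the `c⋆`-localisation under the `σ`-lower ranks. -/
def StarLocalisationσ : Prop :=
  ∀ (n : ℕ) (x : Fin n → ℂ), (ConjLowerRanks n ∧ CE n x) → CS x →
    ∃ c : ℕ, ∃ y : Fin n → ℂ, (ConjLowerRanks n ∧ CE n y) ∧ CS y ∧ NearOpt n c y

/-- Σ-item `FinCSσ` (crux, the instrument): `FinCS` with the `σ`-lower ranks as hypothesis. -/
def FinCSσ : Prop :=
  ∀ (n c : ℕ), ConjLowerRanks n → ∀ y : Fin n → ℂ, NearOpt n c y → CS y → (¬ LinearIndependent ℚ y ∨ ¬ FreeRel n c y)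

/-- Σ-item `BridgeCSσ` (crux, round-2 granularity; splits by product / tower / hull exactly as `BridgeCS` did). -/
def BridgeCSσ : Prop :=
  ∀ (n c : ℕ), ConjLowerRanks n → ∀ y : Fin n → ℂ, NearOpt n c y → CS y → CE n y → FreeRel n c y

/-- The `c⋆`-localisation from presentability — verbatim the landed `starLocalisation_holds` with its one transcendence
input (`firstFailure_khovanskii`) replaced by the hypothesis `SigmaPresentable`. -/
theorem starLocalisationσ_of_sigmaPresentable (hP : SigmaPresentable) : StarLocalisationσ := by
  classical
  intro n x hx hcs
  obtain ⟨g₀, hzero₀, hdet₀⟩ := hP n x hx.1 hx.2 hcs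
  set c₀ : ℕ := Finset.univ.sup fun i => max (g₀ i).totalDegree
    ((g₀ i).support.sup fun m => max ((g₀ i).coeff m).num.natAbs ((g₀ i).coeff m).den) with hc₀
  have hsz₀ : ∀ i, max (g₀ i).totalDegree
      ((g₀ i).support.sup fun m => max ((g₀ i).coeff m).num.natAbs ((g₀ i).coeff m).den) ≤ c₀ := fun i =>
    Finset.le_sup (f := fun i => max (g₀ i).totalDegree
      ((g₀ i).support.sup fun m => max ((g₀ i).coeff m).num.natAbs ((g₀ i).coeff m).den)) (Finset.mem_univ i)
  have hex : ∃ c : ℕ, ∃ y' : Fin n → ℂ, Submodule.span ℚ (Set.range x) = Submodule.span ℚ (Set.range y') ∧ (∃ g' : Fin n → MvPolynomial (Fin n ⊕ Fin n) ℚ, (∀ i, max (g' i).totalDegree ((g' i).support.sup fun m => max ((g' i).coeff m).num.natAbs ((g' i).coeff m).den) ≤ c) ∧ (∀ i, MvPolynomial.aeval (Sum.elim y' (Complex.exp ∘ y')) (g' i) = 0) ∧ (Matrix.of fun i j => MvPolynomial.aeval (Sum.elim y' (Complex.exp ∘ y')) (Literature.NumberTheory.Transcendental.Khovanskii.ePD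 j (g' i))).det ≠ 0) ∧ ‖y'‖ ≤ ((4 ^ c : ℕ) : ℝ) := by
    refine ⟨max c₀ ⌈‖x‖⌉₊, x, rfl, ⟨g₀, fun i => (hsz₀ i).trans (le_max_left _ _), hzero₀, hdet₀⟩, ?_⟩
    have h1 : ‖x‖ ≤ (⌈‖x‖⌉₊ : ℝ) := Nat.le_ceil _
    have h2 : ⌈‖x‖⌉₊ ≤ max c₀ ⌈‖x‖⌉₊ := le_max_right _ _
    have h3 : max c₀ ⌈‖x‖⌉₊ ≤ 4 ^ (max c₀ ⌈‖x‖⌉₊) :=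
      (Nat.lt_two_pow_self).le.trans (Nat.pow_le_pow_left (by norm_num) _)
    calc ‖x‖ ≤ (⌈‖x‖⌉₊ : ℝ) := h1
      _ ≤ ((4 ^ (max c₀ ⌈‖x‖⌉₊) : ℕ) : ℝ) := by exact_mod_cast h2.trans h3
  obtain ⟨y, hxy, hpres, hnorm⟩ := Nat.find_spec hex
  refine ⟨Nat.find hex, y, ⟨hx.1, RootDecomp1HStarLocalisation.linearIndependent_of_span_eq hxy hx.2.1,
    RootDecomp1HProductCells.trdeg_lt_of_span_eq hxy hx.2.2⟩,
    RootDecomp1HStarLocalisation.conjStable_of_span_eq hxy hcs, ⟨hpres, hnorm⟩, ?_⟩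
  intro c' hc' hbad
  refine Nat.find_min hex hc' ?_
  obtain ⟨y', hyy', hg', hn'⟩ := hbad
  exact ⟨y', hxy.trans hyy', hg', hn'⟩

/-- **Σ-DECIDING THEOREM**: with the items indexed by `σ`-STABLE rank there is NO conjugation binder — the induction proves
`ConjSchanuelRank n` for all `n` and the padding `schanuel_iff_conjSchanuel` finishes. -/
theorem closes_sigma (h₀ : StarLocalisationσ) (h₂ : FinCSσ) (h₃ : BridgeCSσ) : _root_.Schanuel := by
  rw [schanuel_iff_conjSchanuel]
  intro n
  induction n using Nat.strong_induction_on with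
  | _ n ih =>
    intro x hli hcs
    by_contra hlt
    rw [not_le] at hlt
    obtain ⟨c, y, hy, hycs, hopt⟩ := h₀ n x ⟨ih, hli, hlt⟩ hcs
    rcases h₂ n c hy.1 y hopt hycs with hdep | hfree
    · exact hdep hy.2.1
    · exact hfree (h₃ n c hy.1 y hopt hycs hy.2)

/-- The same with the localisation reduced to the `σ`-presentability lemma. -/
theorem closes_sigma' (hP : SigmaPresentable) (h₂ : FinCSσ) (h₃ : BridgeCSσ) : _root_.Schanuel :=
  closes_sigma (starLocalisationσ_of_sigmaPresentable hP) h₂ h₃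

/-- The Σ-items are formally STRONGER than the live ones (their lower-rank hypothesis is weaker) … -/
theorem finCS_of_finCSσ (h : FinCSσ) : FinCS :=
  fun n c hlow y hopt hcs => h n c (conjLowerRanks_of_lowerRanks hlow) y hopt hcs

/-- `BridgeCSσ ⟹ BridgeCS` (the σ-item has the weaker lower-rank hypothesis). -/
theorem bridgeCS_of_bridgeCSσ (h : BridgeCSσ) : BridgeCS :=
  fun n c hlow y hopt hcs hce => h n c (conjLowerRanks_of_lowerRanks hlow) y hopt hcs hce

/-- … and `BridgeCSσ`, `StarLocalisationσ` are necessary (vacuously, like every first-failure-local piece). -/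
theorem bridgeCSσ_of_schanuel (h : _root_.Schanuel) : BridgeCSσ :=
  fun n _ _ y _ _ hce => absurd (h n y hce.1) (not_le.2 hce.2)

/-- `StarLocalisationσ` is necessary (vacuously under S). -/
theorem starLocalisationσ_of_schanuel (h : _root_.Schanuel) : StarLocalisationσ :=
  fun n x hx _ => absurd (h n x hx.2.1) (not_le.2 hx.2.2)

end Summit.Schanuel.Schanuel.Theorems.RootDecomp1HMirror
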